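import Summits.ResolutionOfSingularities.ResolutionOfSingularities.Theorems.FrobeniusClosingPatchingRelPerfectCoreRungGraphQuotient
import Summits.ResolutionOfSingularities.ResolutionOfSingularities.Theorems.FrobeniusClosingPatchingRelPerfectCoreRungSquarePlusLinearCharts
import HarnessLib

/-!
# Crux `PatchingRelPerfect` (stmt-ResolutionOfSingularities-16161), chain w52 — CORE RUNG r1e:
# the first mixed-order NON-MONOMIAL member `I = (x₁³, x₂³, x₃³, x₄³, x₁x₂ + x₃x₄)` has
# companion `𝔪`, kernel-checked

[OURS · L1 W5.2 · rung] CHAIN.md v1.1/v1.2 hard-instance hunt (c″), member r1e (decided FOUND by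
hand, here in Lean): for `S` regular local with minimal basis `x = (x₀, x₁, x₂, x₃)` of `𝔪`
(dimension `4`) and `I = (x₀³, x₁³, x₂³, x₃³, x₀x₁ + x₂x₃)` — `𝔪`-primary, `I ⊆ 𝔪²`, NOT a
reduction of a power of `𝔪`, not monomial — every blow-up `T = Bl_I Spec S` satisfies the
conclusion of the blow-up-form core `AtomDimFourBlowupAt`, with companion `Q = 𝔪`: on the Rees
chart `B_i` of `Bl_𝔪 Spec S`,

  `I · B_i = x_i² · (x_i, e_a + e_b e_d)`   (`map_chartBase_cubesQuadric`; `{i, a}`, `{b, d}` the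
  two pairs of the quadric),

the exceptional parameter squared times the ideal of the REGULAR centre "exceptional divisor ∩
strict transform of the quadric cone" (`B_i ⧸ (x_i, e_a + e_b e_d) ≅ κ[T₀, T₁]`,
`isRegularRing_chartRing_quot_graph` of `…CoreRungGraphQuotient.lean`), so Liu 8.1.19 (a) applies
chart by chart and `atomConclusion_of_pointBlowup_charts` assembles.  An instance of the
tangent-cone rung r1t with the chart input discharged.  BC5-type FORMAT evidence for the core on the
first member of the hunt family outside the monomial / `𝔪`-power-reduction strata; nothing here
is a statement of the manuscript under review.

* `map_chartBase_cubesQuadric` — the chart factorisation (any commutative `S`);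
* `isRegular_of_isBlowup_chart_cubesQuadric` — the chart statement;
* `coreRung_cubesQuadric` — the rung; `atomDimFourBlowupAt_cubesQuadric` — the registered core's
  binder shape restricted to the member.

## References

* The Stacks Project, Tags 080A, 0804, 0BIQ. [StacksProject]
* Q. Liu, *Algebraic Geometry and Arithmetic Curves*, OUP 2002, Thm. 8.1.19 (a). [Liu2002]
-/

-- `Summit.<Summit>.<Sub>.Theorems` with `Sub = Summit` (single-conjunct summit, D-0017)
set_option linter.dupNamespace false

noncomputable section

open CategoryTheory CategoryTheory.Limits AlgebraicGeometry Literature.AlgebraicGeometry.Resolution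
open scoped Pointwise

namespace Summit.ResolutionOfSingularities.ResolutionOfSingularities.Theorems

universe u

section CubesQuadric

variable {S : Type u} [CommRing S] (x : Fin 4 → S)

local notation3 "Iq" => Ideal.span (Set.range (fun j : Fin 4 => x j ^ 3) ∪
  {x 0 * x 1 + x 2 * x 3})

/-- **The total transform of `I = (x₀³, …, x₃³, x₀x₁ + x₂x₃)` on the chart `D₊(x_i t)` of
`Bl_{(x)}`**: `I · B_i = x_i² · (x_i, e_a + e_b·e_d)` where `x_i x_a + x_b x_d` is the quadric.
[cite: StacksProject, Tag 0804] -/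
theorem map_chartBase_cubesQuadric (i a b d : Fin 4)
    (hq : x i * x a + x b * x d = x 0 * x 1 + x 2 * x 3) :
    (Iq).map (chartBase x i) = Ideal.span {chartBase x i (x i) ^ 2} *
      Ideal.span {chartBase x i (x i), chartGen x i a + chartGen x i b * chartGen x i d} := by
  have hψ : ∀ j, chartBase x i (x j) = chartBase x i (x i) * chartGen x i j :=
    reesChartBase_apply_eq_mul_chartGen x i
  have hui : chartGen x i i = 1 := chartGen_self x i
  have hcube : ∀ j, chartBase x i (x j ^ 3) =
      chartBase x i (x i) ^ 2 * (chartBase x i (x i) * chartGen x i j ^ 3) := by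
    intro j; rw [map_pow, hψ j]; ring
  have hquad : chartBase x i (x 0 * x 1 + x 2 * x 3) =
      chartBase x i (x i) ^ 2 * (chartGen x i a + chartGen x i b * chartGen x i d) := by
    rw [← hq, map_add, map_mul, map_mul, hψ a, hψ b, hψ d]; ring
  have hg3 : chartBase x i (x i) ^ 2 * chartBase x i (x i) = chartBase x i (x i ^ 3) := by
    rw [map_pow]; ring
  apply le_antisymm
  · rw [Ideal.map_span, Ideal.span_le]
    rintro _ ⟨s, hs, rfl⟩
    rcases hs with ⟨j, rfl⟩ | hs
    · show chartBase x i (x j ^ 3) ∈ _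
      rw [hcube j]
      exact Ideal.mul_mem_mul (Ideal.mem_span_singleton_self _)
        (Ideal.mul_mem_right _ _ (Ideal.subset_span (Set.mem_insert _ _)))
    · rw [Set.mem_singleton_iff] at hs
      subst hs
      rw [SetLike.mem_coe, hquad]
      exact Ideal.mul_mem_mul (Ideal.mem_span_singleton_self _)
        (Ideal.subset_span (Set.mem_insert_of_mem _ rfl))
  · rw [Ideal.span_mul_span', Ideal.span_le]
    rintro _ ⟨p, hp, r, hr, rfl⟩
    rw [Set.mem_singleton_iff] at hp
    subst hp
    rw [Set.mem_insert_iff, Set.mem_singleton_iff] at hr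
    rcases hr with rfl | rfl
    · show chartBase x i (x i) ^ 2 * chartBase x i (x i) ∈ (Iq).map (chartBase x i)
      rw [hg3]
      exact Ideal.mem_map_of_mem _ (Ideal.subset_span (Or.inl ⟨i, rfl⟩))
    · show chartBase x i (x i) ^ 2 * (chartGen x i a + chartGen x i b * chartGen x i d) ∈
        (Iq).map (chartBase x i)
      rw [← hquad]
      exact Ideal.mem_map_of_mem _ (Ideal.subset_span (Or.inr rfl))

variable [IsRegularLocalRing S] (hx : Ideal.span (Set.range x) = IsLocalRing.maximalIdeal S)
  (hd : (IsLocalRing.maximalIdeal S).spanFinrank = 4)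

include hx hd in
/-- **Chart statement**: every blow-up of the chart `Spec B_i` along `I · B_i = x_i²·(x_i, e_a + e_b e_d)`
is regular — twist off `x_i²`, then Liu 8.1.19 (a) for the regular centre `(x_i, e_a + e_b e_d)`
(`isRegularRing_chartRing_quot_graph`). [cite: Liu2002, Thm. 8.1.19 (a)] -/
theorem isRegular_of_isBlowup_chart_cubesQuadric (i a b d : Fin 4)
    (hq : x i * x a + x b * x d = x 0 * x 1 + x 2 * x 3) (hia : i ≠ a) (hib : i ≠ b)
    (hid : i ≠ d) (hab : a ≠ b) (had : a ≠ d) (hbd : b ≠ d)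
    (hall : ∀ j : Fin 4, j = i ∨ j = a ∨ j = b ∨ j = d) {Y : Scheme.{u}}
    {ρ : Y ⟶ Spec (.of (chartRing x i))}
    (hρ : IsBlowup ρ (affineBlowup.idealSheaf ((Iq).map (chartBase x i)))) :
    Scheme.IsRegular Y := by
  rw [map_chartBase_cubesQuadric x i a b d hq] at hρ
  haveI : IsRegularRing S := isRegularRing_of_isRegularLocalRing S
  haveI : IsRegularRing (S ⧸ Ideal.span (Set.range x)) := by
    haveI : (Ideal.span (Set.range x)).IsMaximal := hx ▸ IsLocalRing.maximalIdeal.isMaximal S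
    letI := Ideal.Quotient.field (Ideal.span (Set.range x))
    infer_instance
  have hqr : IsQuasiRegular x := isQuasiRegular_regularSystemOfParameters hd x hx
  haveI : IsRegularRing (chartRing x i) := isRegularRing_blowupChart x i hqr
  haveI : IsRegularRing (chartRing x i ⧸
      Ideal.span {chartBase x i (x i), chartGen x i a + chartGen x i b * chartGen x i d}) := by
    have huniv : ∀ j : {j : Fin 4 // j ≠ i}, j = ⟨a, hia.symm⟩ ∨ j = ⟨b, hib.symm⟩ ∨
        j = ⟨d, hid.symm⟩ := by
      intro j
      rcases hall j.1 with h | h | h | h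
      · exact absurd h j.2
      · exact Or.inl (Subtype.ext h)
      · exact Or.inr (Or.inl (Subtype.ext h))
      · exact Or.inr (Or.inr (Subtype.ext h))
    exact isRegularRing_chartRing_quot_graph x i ⟨a, hia.symm⟩ ⟨b, hib.symm⟩ ⟨d, hid.symm⟩ hqr
      (fun h => hab (congrArg Subtype.val h)) (fun h => had (congrArg Subtype.val h))
      (fun h => hbd (congrArg Subtype.val h)) huniv
  exact isRegular_of_isBlowup_idealSheaf_span_singleton_mul
    (pow_mem (reesChartBase_mem_nonZeroDivisors (x i)
      (Ideal.mem_span_range_self (f := x) (x := i))) 2) _ hρ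

include hx hd in
/-- **CORE RUNG r1e: `I = (x₀³, x₁³, x₂³, x₃³, x₀x₁ + x₂x₃)` has companion `𝔪`.** For `S` regular
local with minimal basis `x` of `𝔪` of length `4`, every blow-up `T = Bl_I Spec S` carries a
non-zero ideal sheaf cosupported in the closed fibre with regular blowing up (the conclusion of the
blow-up-form core `AtomDimFourBlowupAt`): `Bl_{I·𝔪} = Bl_𝔪` followed by the blow-up of the regular
centres `(x_i, e_a + e_b e_d)` (exceptional divisor ∩ strict transform of the quadric cone) is
regular. [cite: StacksProject, Tag 080A] [cite: Liu2002, Thm. 8.1.19 (a)] -/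
theorem coreRung_cubesQuadric (T : Scheme.{u}) (f : T ⟶ Spec (.of S))
    (hf : IsBlowup f (affineBlowup.idealSheaf (Iq))) :
    ∃ (J : T.IdealSheafData) (T' : Scheme.{u}) (π : T' ⟶ T), J ≠ ⊥ ∧
      (∀ t : T, t ∈ J.support → f.base t = IsLocalRing.closedPoint S) ∧
      IsBlowup π J ∧ Scheme.IsRegular T' := by
  haveI : IsDomain S := isDomain_of_isRegularLocalRing S
  have hx0 : x 0 ≠ 0 :=
    (isRsopPart_comp_of_rsop hd x hx id Function.injective_id).ne_zero 0
  have h𝔪 : IsLocalRing.maximalIdeal S ≠ ⊥ := fun h =>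
    hx0 ((Submodule.eq_bot_iff _).mp h _ (hx ▸ Ideal.subset_span ⟨0, rfl⟩))
  have hI : (Iq) ≠ ⊥ := fun h =>
    pow_ne_zero 3 hx0 ((Submodule.eq_bot_iff _).mp h _ (Ideal.subset_span (Or.inl ⟨0, rfl⟩)))
  refine atomConclusion_of_pointBlowup_charts x hx h𝔪 hI (Q₀ := ⊤) (N := 0) le_top
    (fun i Y ρ hρ => ?_) T f hf
  rw [Ideal.mul_top] at hρ
  have hall : ∀ j : Fin 4, j = 0 ∨ j = 1 ∨ j = 2 ∨ j = 3 := by decide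
  fin_cases i
  · exact isRegular_of_isBlowup_chart_cubesQuadric x hx hd 0 1 2 3 rfl (by decide) (by decide)
      (by decide) (by decide) (by decide) (by decide) hall hρ
  · exact isRegular_of_isBlowup_chart_cubesQuadric x hx hd 1 0 2 3 (by rw [mul_comm (x 1) (x 0)])
      (by decide) (by decide) (by decide) (by decide) (by decide) (by decide)
      (fun j => by rcases hall j with h | h | h | h <;> simp [h]) hρ
  · exact isRegular_of_isBlowup_chart_cubesQuadric x hx hd 2 3 0 1 (by rw [add_comm])
      (by decide) (by decide) (by decide) (by decide) (by decide) (by decide)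
      (fun j => by rcases hall j with h | h | h | h <;> simp [h]) hρ
  · exact isRegular_of_isBlowup_chart_cubesQuadric x hx hd 3 2 0 1
      (by rw [mul_comm (x 3) (x 2), add_comm]) (by decide) (by decide) (by decide) (by decide)
      (by decide) (by decide) (fun j => by rcases hall j with h | h | h | h <;> simp [h]) hρ

/-- **The registered core's binder shape, restricted to the member** (hypotheses of
`stub_atomDimFourBlowup`; characteristic, completeness, residue field and the off-fibre hypothesis
unused; the dimension enters as the length `4` of the minimal basis `x`).
[cite: StacksProject, Tag 080A] [cite: Liu2002, Thm. 8.1.19 (a)] -/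
theorem atomDimFourBlowupAt_cubesQuadric (p : ℕ) (_hp : p.Prime) (S : Type) [CommRing S]
    [IsRegularLocalRing S] [CharP S p] [IsAdicComplete (IsLocalRing.maximalIdeal S) S]
    [PerfectField (IsLocalRing.ResidueField S)] (_hS : ringKrullDim S = (4 : ℕ))
    (x : Fin 4 → S) (hx : Ideal.span (Set.range x) = IsLocalRing.maximalIdeal S)
    (hd : (IsLocalRing.maximalIdeal S).spanFinrank = 4)
    (T : Scheme.{0}) (f : T ⟶ Spec (.of S))
    (hf : IsBlowup f (affineBlowup.idealSheaf
      (Ideal.span (Set.range (fun j : Fin 4 => x j ^ 3) ∪ {x 0 * x 1 + x 2 * x 3}))))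
    (_hoff : ∀ t : T, f.base t ≠ IsLocalRing.closedPoint S →
      IsRegularLocalRing (T.presheaf.stalk t)) :
    ∃ (J : T.IdealSheafData) (T' : Scheme.{0}) (π : T' ⟶ T), J ≠ ⊥ ∧
      (∀ t : T, t ∈ J.support → f.base t = IsLocalRing.closedPoint S) ∧
      IsBlowup π J ∧ Scheme.IsRegular T' :=
  coreRung_cubesQuadric x hx hd T f hf

end CubesQuadric

end Summit.ResolutionOfSingularities.ResolutionOfSingularities.Theorems

end
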